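import Literature.Analysis.ValidatedNumerics.TaylorModelIntegralCertFamily
import Mathlib.Analysis.SpecialFunctions.ImproperIntegrals
import Mathlib.MeasureTheory.Integral.IntegralEqImproper
import Mathlib.Analysis.SpecialFunctions.Pow.Asymptotics
import HarnessLib

/-!
# Kernel-checkable certificates for improper integrals `∫_u^{+∞} f·g`

Trunk T-ANA (Analysis/ValidatedNumerics); namespace `Literature.Analysis.ValidatedNumerics.PolyMP`.

The certificate files `TaylorModelIntegralCert*.lean` bound PROPER integrals `∫_a^b f·q` panel by panel (segment
predicate `FSegOK`, glued by `FSegOK.append`).  This file adds the REMAINDER of an improper integral on a half-line,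
following Mahboubi–Melquiond–Sibut-Pinote (J. Autom. Reasoning 62 (2019), Sect. 4): the integral is split into a proper
part `[a, u]`, treated by the existing certificates, and a remainder `∫_u^{+∞} f·g` where `f` is bounded and `g`
belongs to a catalogue of constant-sign functions with known integral (op. cit., Sect. 4.1 Lemma 4 / Lemma 5:
`∫_u^∞ f g ∈ hull{f(t) | t ≥ u} · ∫_u^∞ g`; Sect. 4.2.1: Bertrand's `x^α ln^β x`, eqs. (3), (4); Sect. 4.2.2: `e^{γx}`).

* `FTailOK φ S a lo hi` — the TAIL PREDICATE `lo ≤ S·∫_{(a,∞)} φ ≤ hi ∧ IntegrableOn φ (a,∞)`, the half-line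
  analogue of `FSegOK`; `FSegOK.appendTail` glues a certified proper segment `[a, b]` to a certified tail from `b`
  (additivity, op. cit. Sect. 4 first paragraph), `FTailOK.bounds` reads real bounds off it, `FTailOK.congr` transports
  it along a pointwise identity on the half-line (program semantics are total functions that agree with the intended
  integrand only on the domain).
* **Lemma 4** (op. cit., Sect. 4.1): `integrableOn_Ioi_bdd_mul`, `integral_Ioi_bdd_mul_bounds`,
  `integral_Ioi_bdd_mul_mem_hull` — for `f` a.e.-strongly measurable with `m ≤ f ≤ M` on `(u, ∞)` and `g ≥ 0`
  integrable there, `f·g` is integrable and `∫ f g = θ · ∫ g` for some `θ ∈ [m, M]`.  (The paper assumes `f, g`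
  continuous; measurability of `f` is what the proof uses.)  **Lemma 5** (its effective version) is `FTailOK.bddMul`:
  an interval `F ∋ f(x)` for all `x > u` times a certified tail of `g` is a certified tail of `f·g`.
* The CATALOGUE `Scale`: `expAff a b` = `x ↦ e^{a + b x}` (admissible when `b < 0`; op. cit. Sect. 4.2.2,
  `∫_u^∞ e^{γx} dx = −e^{γu}/γ`) and `powLog n m` = `x ↦ ln^m x / x^n` (admissible when `n ≥ 2`, `u ≥ 1`; op. cit.
  Sect. 4.2.1 with `α = −n`, `β = m ∈ ℕ`: the closed form by the recurrence on `β` from eqs. (3) and (4)), with the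
  real theorems `integral_Ioi_expAff`, `integral_Ioi_powLog` (value `bertrandTail n u m`), integrability and sign, and
  the KERNEL ENCLOSURES `Scale.tailI` of `∫_u^∞ g` in the multiprecision interval arithmetic `MI` (`MI.expPt`,
  `MI.logPos`, exact rational constants), with `Scale.mem_tailI`.
* The certificates `tailCheckI S Ke ke Kl s u F lo hi` (bounded factor given by an interval `F` at scale `S`) and
  `tailCheckR … s u m M lo hi` (given by rational bounds `m ≤ f ≤ M`), `Bool`-valued and kernel-reducible, with the
  soundness theorems `ftailOK_of_tailCheckI` / `ftailOK_of_tailCheckR`.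

Deliberately NOT here: the singular endpoint `0⁺` (op. cit. Sect. 4.3, Lemma 6, by the substitution `t = 1/x`), the
cases `α < −1, β < 0` and `α = −1, β < −1` of Sect. 4.2.1, the automatic range evaluation of the bounded factor on the
half-line (the interval `F` / the bounds `m, M` are hypotheses here), and any splitting heuristic (Sect. 3.4 / 4: the
splitting point is certificate data chosen by the untrusted generator).  Problem-independent plumbing; no facts, no
axioms.

## References

* A. Mahboubi, G. Melquiond, T. Sibut-Pinote, *Formally verified approximations of definite integrals*, J. Automated
  Reasoning 62 (2019) 281–300: Sect. 4.1 Lemma 4, Lemma 5; Sect. 4.2.1 eqs. (3), (4); Sect. 4.2.2.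
  [cite: MahboubiMelquiondSibutpinote2018, Sect. 4]
* A. Mahboubi, G. Melquiond, T. Sibut-Pinote, *Formally verified approximations of definite integrals*, ITP 2016,
  LNCS 9807, 274–289: Sect. 3.3 (additivity of certified enclosures). [cite: MahboubiMelquiondSibutpinote2016, Sect. 3.3]
-/

open MeasureTheory intervalIntegral Set Filter

namespace Literature.Analysis.ValidatedNumerics

namespace PolyMP

open Literature.Analysis.ValidatedNumerics.NumericsMP
open Literature.Analysis.ValidatedNumerics.ExpPoly (Poly BPoly)
open Literature.Analysis.ValidatedNumerics.ExpPoly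

/-! ### The tail predicate and its glue -/

/-- **Tail predicate**: the scaled improper integral `S·∫_{(a,∞)} φ` lies in `[lo, hi]` and `φ` is integrable on the
half-line `(a, ∞)` — the half-line analogue of the segment predicate `FSegOK`.
[cite: MahboubiMelquiondSibutpinote2018, Sect. 4] -/
def FTailOK (φ : ℝ → ℝ) (S : ℕ) (a : ℚ) (lo hi : ℤ) : Prop :=
  (lo : ℝ) ≤ S * ∫ t in Ioi (a : ℝ), φ t ∧
    S * ∫ t in Ioi (a : ℝ), φ t ≤ (hi : ℝ) ∧ IntegrableOn φ (Ioi (a : ℝ))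

/-- A certified tail is transported along an identity of the integrands on the open half-line (the certified
function is a program's total semantics, which agrees with the intended integrand on the integration domain only).
[cite: MahboubiMelquiondSibutpinote2016, Sect. 4.1] -/
theorem FTailOK.congr {φ ψ : ℝ → ℝ} {S : ℕ} {a : ℚ} {lo hi : ℤ} (h : FTailOK φ S a lo hi)
    (he : ∀ x, (a : ℝ) < x → φ x = ψ x) : FTailOK ψ S a lo hi := by
  obtain ⟨h1, h2, h3⟩ := h
  have hE : EqOn φ ψ (Ioi (a : ℝ)) := fun x hx => he x hx
  rw [setIntegral_congr_fun measurableSet_Ioi hE] at h1 h2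
  exact ⟨h1, h2, h3.congr_fun hE measurableSet_Ioi⟩

/-- **Gluing a proper segment to a tail**: `∫_a^b + ∫_{(b,∞)} = ∫_{(a,∞)}` for the certified enclosures
(additivity of the integral; the improper integral is "split into a proper part, treated with the previous methods,
and the remainder"). [cite: MahboubiMelquiondSibutpinote2018, Sect. 4] -/
theorem FSegOK.appendTail {f : ℝ → ℝ} {q : Poly} {S : ℕ} {a b : ℚ} {lo₁ hi₁ lo₂ hi₂ : ℤ}
    (h₁ : FSegOK f q S a b lo₁ hi₁) (hab : a ≤ b)
    (h₂ : FTailOK (fun t => f t * Poly.eval q t) S b lo₂ hi₂) :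
    FTailOK (fun t => f t * Poly.eval q t) S a (lo₁ + lo₂) (hi₁ + hi₂) := by
  obtain ⟨l1, u1, i1⟩ := h₁
  obtain ⟨l2, u2, i2⟩ := h₂
  have habR : ((a : ℚ) : ℝ) ≤ ((b : ℚ) : ℝ) := by exact_mod_cast hab
  have i1' : IntegrableOn (fun t => f t * Poly.eval q t) (Ioc (a : ℝ) (b : ℝ)) :=
    (intervalIntegrable_iff_integrableOn_Ioc_of_le habR).1 i1
  have iA : IntegrableOn (fun t => f t * Poly.eval q t) (Ioi (a : ℝ)) := by
    rw [← Ioc_union_Ioi_eq_Ioi habR]; exact i1'.union i2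
  have e := intervalIntegral.integral_interval_add_Ioi iA i2
  refine ⟨?_, ?_, iA⟩
  · rw [← e, mul_add]; push_cast; linarith
  · rw [← e, mul_add]; push_cast; linarith

/-- From a certified tail to bounds on the improper integral itself (`lo'·S ≤ lo`, `hi ≤ hi'·S`), as `FSegOK.bounds`
does for a proper segment. [cite: MahboubiMelquiondSibutpinote2018, Sect. 4] -/
theorem FTailOK.bounds {φ : ℝ → ℝ} {S : ℕ} {a : ℚ} {lo hi : ℤ} (ht : FTailOK φ S a lo hi) (hS : 0 < S)
    {lo' hi' : ℚ} (hlo : lo' * S ≤ lo) (hhi : (hi : ℚ) ≤ hi' * S) :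
    (lo' : ℝ) ≤ ∫ t in Ioi (a : ℝ), φ t ∧ ∫ t in Ioi (a : ℝ), φ t ≤ (hi' : ℝ) := by
  obtain ⟨l, u, -⟩ := ht
  have hSr : (0 : ℝ) < S := by exact_mod_cast hS
  have hloR : (lo' : ℝ) * S ≤ (lo : ℝ) := by exact_mod_cast hlo
  have hhiR : (hi : ℝ) ≤ (hi' : ℝ) * S := by exact_mod_cast hhi
  rw [mul_comm (S : ℝ)] at l u
  exact ⟨le_of_mul_le_mul_right (hloR.trans l) hSr, le_of_mul_le_mul_right (u.trans hhiR) hSr⟩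

/-! ### Lemma 4: the improper integral of a bounded function times a non-negative integrable one -/

/-- **Lemma 4, existence**: if `f` is (a.e.-strongly) measurable and bounded on `(u, ∞)` and `g` is integrable there,
then `f·g` is integrable on `(u, ∞)`. [cite: MahboubiMelquiondSibutpinote2018, Sect. 4.1 Lemma 4] -/
theorem integrableOn_Ioi_bdd_mul {f g : ℝ → ℝ} {u m M : ℝ}
    (hf : AEStronglyMeasurable f (volume.restrict (Ioi u))) (hb : ∀ x, u < x → m ≤ f x ∧ f x ≤ M)
    (hg : IntegrableOn g (Ioi u)) : IntegrableOn (fun x => f x * g x) (Ioi u) := by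
  refine Integrable.bdd_mul hg hf (c := max |m| |M|) ?_
  refine ae_restrict_of_forall_mem measurableSet_Ioi fun x hx => ?_
  rw [Real.norm_eq_abs]
  exact abs_le_max_abs_abs (hb x hx).1 (hb x hx).2

/-- **Lemma 4, bounds**: with `m ≤ f ≤ M` on `(u, ∞)` and `g ≥ 0` integrable there,
`m·∫_{(u,∞)} g ≤ ∫_{(u,∞)} f g ≤ M·∫_{(u,∞)} g`. [cite: MahboubiMelquiondSibutpinote2018, Sect. 4.1 Lemma 4] -/
theorem integral_Ioi_bdd_mul_bounds {f g : ℝ → ℝ} {u m M : ℝ}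
    (hf : AEStronglyMeasurable f (volume.restrict (Ioi u))) (hb : ∀ x, u < x → m ≤ f x ∧ f x ≤ M)
    (hg : IntegrableOn g (Ioi u)) (hg0 : ∀ x, u < x → 0 ≤ g x) :
    m * ∫ x in Ioi u, g x ≤ ∫ x in Ioi u, f x * g x ∧
      ∫ x in Ioi u, f x * g x ≤ M * ∫ x in Ioi u, g x := by
  have hfg := integrableOn_Ioi_bdd_mul hf hb hg
  constructor
  · rw [← MeasureTheory.integral_const_mul]
    exact setIntegral_mono_on (Integrable.const_mul hg m) hfg measurableSet_Ioi
      fun x hx => mul_le_mul_of_nonneg_right (hb x hx).1 (hg0 x hx)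
  · rw [← MeasureTheory.integral_const_mul]
    exact setIntegral_mono_on hfg (Integrable.const_mul hg M) measurableSet_Ioi
      fun x hx => mul_le_mul_of_nonneg_right (hb x hx).2 (hg0 x hx)

/-- **Lemma 4, hull form**: under the same hypotheses `∫_{(u,∞)} f g ∈ hull{f(t) | t > u} · ∫_{(u,∞)} g`, i.e.
`∫ f g = θ·∫ g` for some `θ ∈ [m, M]`. [cite: MahboubiMelquiondSibutpinote2018, Sect. 4.1 Lemma 4] -/
theorem integral_Ioi_bdd_mul_mem_hull {f g : ℝ → ℝ} {u m M : ℝ}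
    (hf : AEStronglyMeasurable f (volume.restrict (Ioi u))) (hb : ∀ x, u < x → m ≤ f x ∧ f x ≤ M)
    (hg : IntegrableOn g (Ioi u)) (hg0 : ∀ x, u < x → 0 ≤ g x) :
    ∃ θ : ℝ, m ≤ θ ∧ θ ≤ M ∧ ∫ x in Ioi u, f x * g x = θ * ∫ x in Ioi u, g x := by
  obtain ⟨h1, h2⟩ := integral_Ioi_bdd_mul_bounds hf hb hg hg0
  have hmM : m ≤ M := by
    have := hb (u + 1) (by linarith)
    exact this.1.trans this.2
  have hG0 : 0 ≤ ∫ x in Ioi u, g x := setIntegral_nonneg measurableSet_Ioi fun x hx => hg0 x hx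
  rcases hG0.lt_or_eq with hpos | hzero
  · refine ⟨(∫ x in Ioi u, f x * g x) / ∫ x in Ioi u, g x, ?_, ?_, ?_⟩
    · rw [le_div_iff₀ hpos]; exact h1
    · rw [div_le_iff₀ hpos]; exact h2
    · rw [div_mul_cancel₀ _ hpos.ne']
  · refine ⟨m, le_rfl, hmM, ?_⟩
    rw [← hzero] at h1 h2 ⊢
    rw [mul_zero] at h1 h2 ⊢
    exact le_antisymm h2 h1

/-- **Lemma 5 (effective Lemma 4) in certificate currency**: an interval `F ∋ f(x)` (scale `S`) for every `x > u`
times a certified tail `[glo, ghi] ∋ S·∫_{(u,∞)} g` of a non-negative `g` gives the certified tail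
`F · [glo, ghi] ⊆ [lo, hi]` of `f·g`. [cite: MahboubiMelquiondSibutpinote2018, Sect. 4.1 Lemma 5] -/
theorem FTailOK.bddMul {g : ℝ → ℝ} {S : ℕ} {u : ℚ} {glo ghi : ℤ} (hg : FTailOK g S u glo ghi) (hS : 0 < S)
    (hg0 : ∀ x, (u : ℝ) < x → 0 ≤ g x) {f : ℝ → ℝ}
    (hf : AEStronglyMeasurable f (volume.restrict (Ioi (u : ℝ)))) {F : MI}
    (hF : ∀ x, (u : ℝ) < x → MI.mem S (f x) F) {lo hi : ℤ}
    (hlo : lo ≤ (MI.mul S F ⟨glo, ghi⟩).lo) (hhi : (MI.mul S F ⟨glo, ghi⟩).hi ≤ hi) :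
    FTailOK (fun x => f x * g x) S u lo hi := by
  obtain ⟨g1, g2, gi⟩ := hg
  have hSr : (0 : ℝ) < S := by exact_mod_cast hS
  have hb : ∀ x, (u : ℝ) < x → (F.lo : ℝ) / S ≤ f x ∧ f x ≤ (F.hi : ℝ) / S := fun x hx =>
    ⟨MI.lo_div_le hS (hF x hx), MI.le_hi_div hS (hF x hx)⟩
  obtain ⟨θ, hθ1, hθ2, hθ⟩ := integral_Ioi_bdd_mul_mem_hull hf hb gi hg0
  have hθF : MI.mem S θ F := by
    constructor
    · rw [div_le_iff₀ hSr] at hθ1; exact hθ1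
    · rw [le_div_iff₀ hSr] at hθ2; exact hθ2
  have e1 : (∫ x in Ioi (u : ℝ), g x) * S = S * ∫ x in Ioi (u : ℝ), g x := mul_comm _ _
  have hG : MI.mem S (∫ x in Ioi (u : ℝ), g x) ⟨glo, ghi⟩ :=
    ⟨by rw [e1]; exact g1, by rw [e1]; exact g2⟩
  have hm := MI.mem_mul hS hθF hG
  rw [← hθ] at hm
  obtain ⟨m1, m2⟩ := hm
  have hloR : ((lo : ℤ) : ℝ) ≤ ((MI.mul S F ⟨glo, ghi⟩).lo : ℝ) := by exact_mod_cast hlo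
  have hhiR : ((MI.mul S F ⟨glo, ghi⟩).hi : ℝ) ≤ ((hi : ℤ) : ℝ) := by exact_mod_cast hhi
  refine ⟨?_, ?_, integrableOn_Ioi_bdd_mul hf hb gi⟩
  · rw [mul_comm]; exact hloR.trans m1
  · rw [mul_comm]; exact m2.trans hhiR

/-! ### The catalogue of scale functions -/

/-- **The catalogue of constant-sign integrable functions `g`** (op. cit., Sect. 4.2): `expAff a b` denotes
`x ↦ e^{a + b x}` (the exponential scale `e^{γx}`, Sect. 4.2.2, with an affine exponent so that a shifted tail needs
no extra constant) and `powLog n m` denotes Bertrand's `x ↦ x^{−n} ln^m x` (Sect. 4.2.1 with `α = −n`, `β = m ∈ ℕ`).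
[cite: MahboubiMelquiondSibutpinote2018, Sect. 4.2] -/
inductive Scale
  | expAff (a b : ℚ)
  | powLog (n m : ℕ)

namespace Scale

/-- The real function denoted by a scale. [cite: MahboubiMelquiondSibutpinote2018, Sect. 4.2] -/
noncomputable def toFun : Scale → ℝ → ℝ
  | expAff a b, x => Real.exp (a + b * x)
  | powLog n m, x => Real.log x ^ m / x ^ n

/-- Admissibility of a scale for a tail starting at `u`: `b < 0` for `e^{a+bx}` (Sect. 4.2.2: `γ < 0`); `n ≥ 2` and
`u ≥ 1` for `x^{−n} ln^m x` (Sect. 4.2.1: integrable at `+∞` iff `α < −1`; of constant sign on `[1, ∞)`).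
[cite: MahboubiMelquiondSibutpinote2018, Sect. 4.2] -/
def ok : Scale → ℚ → Bool
  | expAff _ b, _ => decide (b < 0)
  | powLog n _, u => decide (2 ≤ n) && decide (1 ≤ u)

/-- The exponential scale, by name. [cite: MahboubiMelquiondSibutpinote2018, Sect. 4.2.2] -/
@[simp] theorem toFun_expAff (a b : ℚ) (x : ℝ) : (expAff a b).toFun x = Real.exp (a + b * x) := rfl

/-- Bertrand's scale, by name. [cite: MahboubiMelquiondSibutpinote2018, Sect. 4.2.1] -/
@[simp] theorem toFun_powLog (n m : ℕ) (x : ℝ) : (powLog n m).toFun x = Real.log x ^ m / x ^ n := rfl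

end Scale

/-! #### The exponential scale (Sect. 4.2.2) -/

/-- `∫_{(u,∞)} e^{a+bx} dx = e^{a+bu}/(−b)` for `b < 0`. [cite: MahboubiMelquiondSibutpinote2018, Sect. 4.2.2] -/
theorem integral_Ioi_expAff {a b : ℝ} (hb : b < 0) (u : ℝ) :
    ∫ x in Ioi u, Real.exp (a + b * x) = Real.exp (a + b * u) / (-b) := by
  have e : ∀ x, Real.exp (a + b * x) = Real.exp a * Real.exp (b * x) := fun x => by rw [Real.exp_add]
  simp_rw [e, MeasureTheory.integral_const_mul, integral_exp_mul_Ioi hb u]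
  have hb0 : b ≠ 0 := hb.ne
  field_simp

/-- `e^{a+bx}` is integrable on `(u, ∞)` for `b < 0`. [cite: MahboubiMelquiondSibutpinote2018, Sect. 4.2.2] -/
theorem integrableOn_Ioi_expAff {a b : ℝ} (hb : b < 0) (u : ℝ) :
    IntegrableOn (fun x => Real.exp (a + b * x)) (Ioi u) := by
  have e : (fun x => Real.exp (a + b * x)) = fun x => Real.exp a * Real.exp (b * x) := by
    funext x; rw [Real.exp_add]
  rw [e]
  exact Integrable.const_mul (integrableOn_exp_mul_Ioi hb u) _

/-! #### Bertrand's scale `x^{−n} ln^m x` (Sect. 4.2.1) -/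

/-- [folklore] -/
private lemma pow_log_le_rpow_half (m : ℕ) {x : ℝ} (hx : 1 ≤ x) :
    Real.log x ^ m ≤ (2 * (m : ℝ)) ^ m * x ^ (1 / 2 : ℝ) := by
  have hx0 : 0 ≤ x := zero_le_one.trans hx
  rcases Nat.eq_zero_or_pos m with rfl | hm
  · simp only [pow_zero, one_mul]
    exact Real.one_le_rpow hx (by norm_num)
  · have hmr : (0 : ℝ) < m := by exact_mod_cast hm
    have hε : (0 : ℝ) < 1 / (2 * m) := by positivity
    have h1 : Real.log x ≤ x ^ (1 / (2 * (m : ℝ))) / (1 / (2 * m)) := Real.log_le_rpow_div hx0 hε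
    rw [div_div_eq_mul_div, div_one] at h1
    have h0 : 0 ≤ Real.log x := Real.log_nonneg hx
    have hexp : 1 / (2 * (m : ℝ)) * m = 1 / 2 := by field_simp
    calc Real.log x ^ m ≤ (x ^ (1 / (2 * (m : ℝ))) * (2 * m)) ^ m := pow_le_pow_left₀ h0 h1 m
      _ = (2 * (m : ℝ)) ^ m * (x ^ (1 / (2 * (m : ℝ)))) ^ m := by rw [mul_pow, mul_comm]
      _ = (2 * (m : ℝ)) ^ m * x ^ (1 / 2 : ℝ) := by
          rw [← Real.rpow_natCast (x ^ (1 / (2 * (m : ℝ)))) m, ← Real.rpow_mul hx0, hexp]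

/-- `x^{−n} ln^m x` is integrable on `(u, ∞)` for `n ≥ 2`, `u ≥ 1`.
[cite: MahboubiMelquiondSibutpinote2018, Sect. 4.2.1] -/
theorem integrableOn_Ioi_powLog {n : ℕ} (hn : 2 ≤ n) (m : ℕ) {u : ℝ} (hu : 1 ≤ u) :
    IntegrableOn (fun x => Real.log x ^ m / x ^ n) (Ioi u) := by
  have hu0 : 0 < u := one_pos.trans_le hu
  have hnr : (2 : ℝ) ≤ n := by exact_mod_cast hn
  have hdom : IntegrableOn (fun x : ℝ => (2 * (m : ℝ)) ^ m * x ^ ((1 / 2 : ℝ) - n)) (Ioi u) :=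
    Integrable.const_mul (integrableOn_Ioi_rpow_of_lt (by linarith) hu0) _
  have hmeas : AEStronglyMeasurable (fun x => Real.log x ^ m / x ^ n) (volume.restrict (Ioi u)) := by
    refine ContinuousOn.aestronglyMeasurable ?_ measurableSet_Ioi
    refine ContinuousOn.div ?_ (continuous_pow n).continuousOn fun x hx => pow_ne_zero n (hu0.trans hx).ne'
    exact (Real.continuousOn_log.mono fun x hx => (hu0.trans hx).ne').pow m
  refine Integrable.mono' hdom hmeas (ae_restrict_of_forall_mem measurableSet_Ioi fun x hx => ?_)
  have hx1 : 1 ≤ x := hu.trans hx.le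
  have hx0 : 0 < x := hu0.trans hx
  rw [Real.norm_eq_abs, abs_of_nonneg (div_nonneg (pow_nonneg (Real.log_nonneg hx1) m) (pow_nonneg hx0.le n)),
    div_le_iff₀ (pow_pos hx0 n), mul_assoc, ← Real.rpow_natCast x n, ← Real.rpow_add hx0]
  have : (1 / 2 : ℝ) - n + n = 1 / 2 := by ring
  rw [this]
  exact pow_log_le_rpow_half m hx1

/-- [folklore] -/
private lemma tendsto_pow_log_mul_rpow {n : ℕ} (hn : 2 ≤ n) (m : ℕ) :
    Tendsto (fun x : ℝ => Real.log x ^ m * x ^ (1 - (n : ℝ))) atTop (nhds 0) := by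
  have hnr : (2 : ℝ) ≤ n := by exact_mod_cast hn
  have htop : Tendsto (fun x : ℝ => Real.log x ^ m / x) atTop (nhds 0) := by
    simpa using Real.tendsto_pow_log_div_mul_add_atTop 1 0 m one_ne_zero
  refine tendsto_of_tendsto_of_tendsto_of_le_of_le' tendsto_const_nhds htop ?_ ?_
  · filter_upwards [eventually_ge_atTop (1 : ℝ)] with x hx
    exact mul_nonneg (pow_nonneg (Real.log_nonneg hx) m) (Real.rpow_nonneg (zero_le_one.trans hx) _)
  · filter_upwards [eventually_ge_atTop (1 : ℝ)] with x hx
    have h1 : x ^ (1 - (n : ℝ)) ≤ x ^ (-1 : ℝ) := Real.rpow_le_rpow_of_exponent_le hx (by linarith)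
    rw [Real.rpow_neg_one] at h1
    rw [div_eq_mul_inv]
    exact mul_le_mul_of_nonneg_left h1 (pow_nonneg (Real.log_nonneg hx) m)

/-- **The recurrence (4) (and (3) for `m = 0`)**: for `n ≥ 2`, `u ≥ 1`,
`∫_{(u,∞)} ln^m x / x^n dx = ln^m u / ((n−1) u^{n−1}) + (m/(n−1)) · ∫_{(u,∞)} ln^{m−1} x / x^n dx`
(natural-number `m − 1`; for `m = 0` the second term vanishes).
[cite: MahboubiMelquiondSibutpinote2018, Sect. 4.2.1 eq. (4)] -/
theorem integral_Ioi_powLog_rec {n : ℕ} (hn : 2 ≤ n) (m : ℕ) {u : ℝ} (hu : 1 ≤ u) :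
    ∫ x in Ioi u, Real.log x ^ m / x ^ n =
      Real.log u ^ m / ((n - 1) * u ^ (n - 1)) + m / (n - 1) * ∫ x in Ioi u, Real.log x ^ (m - 1) / x ^ n := by
  have hu0 : 0 < u := one_pos.trans_le hu
  have hnr : (2 : ℝ) ≤ n := by exact_mod_cast hn
  have hn1 : (1 : ℝ) - n ≠ 0 := by linarith
  have hn1' : (n : ℝ) - 1 ≠ 0 := by linarith
  -- the primitive `G` and its derivative `G'`
  set G : ℝ → ℝ := fun x => Real.log x ^ m * x ^ (1 - (n : ℝ)) / (1 - n) with hG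
  set G' : ℝ → ℝ := fun x => m / (1 - n) * (Real.log x ^ (m - 1) / x ^ n) + Real.log x ^ m / x ^ n with hG'
  have hderiv : ∀ x ∈ Ici u, HasDerivAt G (G' x) x := by
    intro x hx
    have hx0 : 0 < x := hu0.trans_le hx
    have h1 : HasDerivAt (fun y => Real.log y ^ m) ((m : ℝ) * Real.log x ^ (m - 1) * x⁻¹) x :=
      (Real.hasDerivAt_log hx0.ne').pow m
    have h2 : HasDerivAt (fun y => y ^ (1 - (n : ℝ))) ((1 - (n : ℝ)) * x ^ (1 - (n : ℝ) - 1)) x :=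
      Real.hasDerivAt_rpow_const (Or.inl hx0.ne')
    have h3 := (h1.mul h2).div_const (1 - (n : ℝ))
    refine h3.congr_deriv ?_
    have e1 : x ^ (1 - (n : ℝ)) = x * (x ^ n)⁻¹ := by
      rw [Real.rpow_sub hx0, Real.rpow_one, Real.rpow_natCast, div_eq_mul_inv]
    have e2 : x ^ (1 - (n : ℝ) - 1) = (x ^ n)⁻¹ := by
      rw [show (1 - (n : ℝ) - 1) = -(n : ℝ) by ring, Real.rpow_neg hx0.le, Real.rpow_natCast]
    rw [e1, e2, hG']
    have hxn : x ^ n ≠ 0 := pow_ne_zero n hx0.ne'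
    field_simp
  have hint : IntegrableOn G' (Ioi u) := by
    have h1 := Integrable.const_mul (integrableOn_Ioi_powLog hn (m - 1) hu) ((m : ℝ) / (1 - n))
    exact Integrable.add h1 (integrableOn_Ioi_powLog hn m hu)
  have hlim : Tendsto G atTop (nhds 0) := by
    have := (tendsto_pow_log_mul_rpow hn m).div_const (1 - (n : ℝ))
    rw [zero_div] at this
    exact this
  have key := integral_Ioi_of_hasDerivAt_of_tendsto' hderiv hint hlim
  have hsplit : ∫ x in Ioi u, G' x =
      m / (1 - n) * (∫ x in Ioi u, Real.log x ^ (m - 1) / x ^ n) + ∫ x in Ioi u, Real.log x ^ m / x ^ n := by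
    rw [hG', integral_add (Integrable.const_mul (integrableOn_Ioi_powLog hn (m - 1) hu) _)
      (integrableOn_Ioi_powLog hn m hu), MeasureTheory.integral_const_mul]
  rw [hsplit] at key
  have eG : G u = -(Real.log u ^ m / ((n - 1) * u ^ (n - 1))) := by
    rw [hG]
    have e3 : u ^ (1 - (n : ℝ)) = (u ^ (n - 1))⁻¹ := by
      have : (1 - (n : ℝ)) = -(((n - 1 : ℕ) : ℝ)) := by
        rw [Nat.cast_sub (by omega : 1 ≤ n)]; push_cast; ring
      rw [this, Real.rpow_neg hu0.le, Real.rpow_natCast]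
    simp only [e3]
    have hun : u ^ (n - 1) ≠ 0 := pow_ne_zero _ hu0.ne'
    field_simp
    ring
  rw [eG] at key
  have : ∫ x in Ioi u, Real.log x ^ m / x ^ n =
      0 - -(Real.log u ^ m / ((n - 1) * u ^ (n - 1))) -
        m / (1 - n) * ∫ x in Ioi u, Real.log x ^ (m - 1) / x ^ n := by linarith
  rw [this]
  have e4 : (m : ℝ) / (1 - n) = -(m / (n - 1)) := by
    rw [← neg_sub, div_neg]
  rw [e4]
  ring

/-- **Bertrand tail values** `B(n, m, u) = ∫_{(u,∞)} ln^m x / x^n dx` by the recurrence on `m` from eqs. (3), (4):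
`B(n,0,u) = 1/((n−1)u^{n−1})`, `B(n,m+1,u) = ln^{m+1} u /((n−1)u^{n−1}) + ((m+1)/(n−1))·B(n,m,u)`.
[cite: MahboubiMelquiondSibutpinote2018, Sect. 4.2.1 eqs. (3)(4)] -/
noncomputable def bertrandTail (n : ℕ) (u : ℝ) : ℕ → ℝ
  | 0 => 1 / ((n - 1) * u ^ (n - 1))
  | m + 1 => Real.log u ^ (m + 1) / ((n - 1) * u ^ (n - 1)) + (m + 1) / (n - 1) * bertrandTail n u m

/-- **The closed form of Bertrand's integral** for `α = −n ≤ −2`, `β = m ∈ ℕ`, `u ≥ 1`: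
`∫_{(u,∞)} ln^m x / x^n dx = B(n, m, u)`. [cite: MahboubiMelquiondSibutpinote2018, Sect. 4.2.1 eqs. (3)(4)] -/
theorem integral_Ioi_powLog {n : ℕ} (hn : 2 ≤ n) {u : ℝ} (hu : 1 ≤ u) (m : ℕ) :
    ∫ x in Ioi u, Real.log x ^ m / x ^ n = bertrandTail n u m := by
  induction m with
  | zero =>
    rw [integral_Ioi_powLog_rec hn 0 hu, bertrandTail]
    simp
  | succ k ih =>
    rw [integral_Ioi_powLog_rec hn (k + 1) hu, bertrandTail, Nat.add_sub_cancel, ih]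
    push_cast
    ring

namespace Scale

/-- An admissible scale is non-negative on its half-line. [cite: MahboubiMelquiondSibutpinote2018, Sect. 4.2] -/
theorem toFun_nonneg {s : Scale} {u : ℚ} (hok : s.ok u = true) : ∀ x, (u : ℝ) < x → 0 ≤ s.toFun x := by
  intro x hx
  cases s with
  | expAff a b => exact (Real.exp_pos _).le
  | powLog n m =>
    simp only [ok, Bool.and_eq_true, decide_eq_true_eq] at hok
    have hu1 : (1 : ℝ) ≤ (u : ℝ) := by exact_mod_cast hok.2
    have hx1 : 1 ≤ x := hu1.trans hx.le
    exact div_nonneg (pow_nonneg (Real.log_nonneg hx1) m) (pow_nonneg (zero_le_one.trans hx1) n)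

/-- An admissible scale is integrable on its half-line. [cite: MahboubiMelquiondSibutpinote2018, Sect. 4.2] -/
theorem integrableOn_toFun {s : Scale} {u : ℚ} (hok : s.ok u = true) : IntegrableOn s.toFun (Ioi (u : ℝ)) := by
  cases s with
  | expAff a b =>
    simp only [ok, decide_eq_true_eq] at hok
    have hb : ((b : ℚ) : ℝ) < 0 := by exact_mod_cast hok
    exact integrableOn_Ioi_expAff hb _
  | powLog n m =>
    simp only [ok, Bool.and_eq_true, decide_eq_true_eq] at hok
    have hu1 : (1 : ℝ) ≤ (u : ℝ) := by exact_mod_cast hok.2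
    exact integrableOn_Ioi_powLog hok.1 m hu1

/-! ### Kernel enclosures of the catalogued tails -/

/-- `L^m` in the interval arithmetic, by repeated products. [folklore] -/
def powI (S : ℕ) (L : MI) : ℕ → MI
  | 0 => MI.ofInt S 1
  | m + 1 => MI.mul S (powI S L m) L

/-- Soundness of `powI` (interval evaluation of the powers `ln^j u` in the closed form of eq. (4)).
[cite: MahboubiMelquiondSibutpinote2018, Sect. 4.2.1 eq. (4)] -/
theorem mem_powI {S : ℕ} (hS : 0 < S) {x : ℝ} {L : MI} (hx : MI.mem S x L) :
    ∀ m, MI.mem S (x ^ m) (powI S L m)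
  | 0 => by simpa [powI] using MI.mem_ofInt S 1
  | m + 1 => by rw [pow_succ]; exact MI.mem_mul hS (mem_powI hS hx m) hx

/-- Kernel enclosure of the Bertrand tail value `B(n, m, u)` from an enclosure `L ∋ ln u`, following the recurrence
of `bertrandTail` with exact rational constants. [cite: MahboubiMelquiondSibutpinote2018, Sect. 4.2.1 eqs. (3)(4)] -/
def bertrandTailI (S : ℕ) (n : ℕ) (u : ℚ) (L : MI) : ℕ → MI
  | 0 => ofRat S (1 / ((n - 1) * u ^ (n - 1)))
  | m + 1 => MI.add (MI.mul S (powI S L (m + 1)) (ofRat S (1 / ((n - 1) * u ^ (n - 1)))))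
      (MI.mul S (ofRat S ((m + 1) / (n - 1))) (bertrandTailI S n u L m))

/-- Soundness of `bertrandTailI`: the interval recurrence encloses the real one.
[cite: MahboubiMelquiondSibutpinote2018, Sect. 4.2.1 eqs. (3)(4)] -/
theorem mem_bertrandTailI {S : ℕ} (hS : 0 < S) (n : ℕ) (u : ℚ) {L : MI} (hL : MI.mem S (Real.log u) L) :
    ∀ m, MI.mem S (bertrandTail n u m) (bertrandTailI S n u L m)
  | 0 => by
    have := mem_ofRat S (1 / ((n - 1) * u ^ (n - 1)))
    push_cast at this
    simpa [bertrandTail, bertrandTailI] using this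
  | m + 1 => by
    have hc : MI.mem S ((1 : ℝ) / ((n - 1) * (u : ℝ) ^ (n - 1))) (ofRat S (1 / ((n - 1) * u ^ (n - 1)))) := by
      have := mem_ofRat S (1 / ((n - 1) * u ^ (n - 1))); push_cast at this; exact this
    have hq : MI.mem S (((m : ℝ) + 1) / ((n : ℝ) - 1)) (ofRat S ((m + 1) / (n - 1))) := by
      have := mem_ofRat S ((m + 1) / (n - 1)); push_cast at this; exact this
    have h := MI.mem_add (MI.mem_mul hS (mem_powI hS hL (m + 1)) hc)
      (MI.mem_mul hS hq (mem_bertrandTailI hS n u hL m))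
    simp only [bertrandTail, bertrandTailI]
    convert h using 2
    ring

/-- **Kernel enclosure of the catalogued tail** `∫_{(u,∞)} g`: for `e^{a+bx}`, `e^{a+bu}·(1/(−b))` through
`MI.expPt` (`Ke` series terms, `ke` squarings); for `x^{−n} ln^m x`, `bertrandTailI` with `ln u` from `MI.logPos`
(`Kl` series terms).  `none` if an enclosure primitive declines. [cite: MahboubiMelquiondSibutpinote2018, Sect. 4.2] -/
def tailI (S Ke ke Kl : ℕ) : Scale → ℚ → Option MI
  | expAff a b, u =>
    match MI.expPt S Ke ke (ofRat S (a + b * u)) with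
    | some E => some (MI.mul S E (ofRat S (1 / (-b))))
    | none => none
  | powLog n m, u =>
    match MI.logPos S Kl (ofRat S u) with
    | some L => some (bertrandTailI S n u L m)
    | none => none

/-- **Soundness of the tail enclosure**: `∫_{(u,∞)} g ∈ tailI`. [cite: MahboubiMelquiondSibutpinote2018, Sect. 4.2] -/
theorem mem_tailI {S Ke ke Kl : ℕ} (hS : 0 < S) {s : Scale} {u : ℚ} (hok : s.ok u = true) {G : MI}
    (h : s.tailI S Ke ke Kl u = some G) : MI.mem S (∫ x in Ioi (u : ℝ), s.toFun x) G := by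
  cases s with
  | expAff a b =>
    simp only [ok, decide_eq_true_eq] at hok
    have hb : ((b : ℚ) : ℝ) < 0 := by exact_mod_cast hok
    simp only [tailI] at h
    split at h
    · rename_i E hE
      simp only [Option.some.injEq] at h
      subst h
      simp only [toFun_expAff]
      rw [integral_Ioi_expAff hb, div_eq_mul_one_div]
      have h1 : MI.mem S (Real.exp ((a : ℝ) + (b : ℝ) * (u : ℝ))) E := by
        refine MI.mem_expPt hS hE ?_
        have := mem_ofRat S (a + b * u); push_cast at this; exact this
      have h2 : MI.mem S ((1 : ℝ) / (-(b : ℝ))) (ofRat S (1 / (-b))) := by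
        have := mem_ofRat S (1 / (-b)); push_cast at this; exact this
      exact MI.mem_mul hS h1 h2
    · simp at h
  | powLog n m =>
    simp only [ok, Bool.and_eq_true, decide_eq_true_eq] at hok
    have hu1 : (1 : ℝ) ≤ (u : ℝ) := by exact_mod_cast hok.2
    simp only [tailI] at h
    split at h
    · rename_i L hL
      simp only [Option.some.injEq] at h
      subst h
      simp only [toFun_powLog]
      rw [integral_Ioi_powLog hok.1 hu1 m]
      exact mem_bertrandTailI hS n u (MI.mem_logPos hS hL (mem_ofRat S u)).2 m
    · simp at h

/-- The catalogued tail as a certified tail: `FTailOK g S u G.lo G.hi`. [cite: MahboubiMelquiondSibutpinote2018, Sect. 4.2] -/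
theorem ftailOK_tailI {S Ke ke Kl : ℕ} (hS : 0 < S) {s : Scale} {u : ℚ} (hok : s.ok u = true) {G : MI}
    (h : s.tailI S Ke ke Kl u = some G) : FTailOK s.toFun S u G.lo G.hi := by
  have hm := mem_tailI hS hok h
  refine ⟨?_, ?_, integrableOn_toFun hok⟩
  · rw [mul_comm]; exact hm.1
  · rw [mul_comm]; exact hm.2

end Scale

/-! ### The tail certificates -/

/-- **Tail certificate, interval form**: `S > 0`, the scale admissible from `u`, its tail enclosure defined, and
`F · tailI ⊆ [lo, hi]`, where `F` is an interval (scale `S`) containing every value of the bounded factor on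
`(u, ∞)`. [cite: MahboubiMelquiondSibutpinote2018, Sect. 4.1 Lemma 5] -/
def tailCheckI (S Ke ke Kl : ℕ) (s : Scale) (u : ℚ) (F : MI) (lo hi : ℤ) : Bool :=
  decide (0 < S) && s.ok u &&
    match s.tailI S Ke ke Kl u with
    | none => false
    | some G => decide (lo ≤ (MI.mul S F G).lo) && decide ((MI.mul S F G).hi ≤ hi)

/-- **Soundness of the interval-form tail certificate**: for `f` a.e.-strongly measurable on `(u, ∞)` with
`f(x) ∈ F` for all `x > u`, the tail `S·∫_{(u,∞)} f·g ∈ [lo, hi]` is certified.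
[cite: MahboubiMelquiondSibutpinote2018, Sect. 4.1 Lemma 5] -/
theorem ftailOK_of_tailCheckI {S Ke ke Kl : ℕ} {s : Scale} {u : ℚ} {F : MI} {lo hi : ℤ}
    (hc : tailCheckI S Ke ke Kl s u F lo hi = true) {f : ℝ → ℝ}
    (hf : AEStronglyMeasurable f (volume.restrict (Ioi (u : ℝ))))
    (hF : ∀ x, (u : ℝ) < x → MI.mem S (f x) F) :
    FTailOK (fun x => f x * s.toFun x) S u lo hi := by
  unfold tailCheckI at hc
  simp only [Bool.and_eq_true, decide_eq_true_eq] at hc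
  obtain ⟨⟨hS, hok⟩, hc⟩ := hc
  split at hc
  · simp at hc
  · rename_i G hG
    simp only [Bool.and_eq_true, decide_eq_true_eq] at hc
    exact (Scale.ftailOK_tailI hS hok hG).bddMul hS (Scale.toFun_nonneg hok) hf hF hc.1 hc.2

/-- **Tail certificate, rational-bounds form**: the bounded factor is given by rational bounds `m ≤ f ≤ M` on
`(u, ∞)` (the hull `[m, M]` of Lemma 4). [cite: MahboubiMelquiondSibutpinote2018, Sect. 4.1 Lemma 4] -/
def tailCheckR (S Ke ke Kl : ℕ) (s : Scale) (u m M : ℚ) (lo hi : ℤ) : Bool :=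
  tailCheckI S Ke ke Kl s u (MI.span (ofRat S m) (ofRat S M)) lo hi

/-- **Soundness of the rational-bounds tail certificate.** [cite: MahboubiMelquiondSibutpinote2018, Sect. 4.1 Lemma 4] -/
theorem ftailOK_of_tailCheckR {S Ke ke Kl : ℕ} {s : Scale} {u m M : ℚ} {lo hi : ℤ}
    (hc : tailCheckR S Ke ke Kl s u m M lo hi = true) {f : ℝ → ℝ}
    (hf : AEStronglyMeasurable f (volume.restrict (Ioi (u : ℝ))))
    (hb : ∀ x, (u : ℝ) < x → (m : ℝ) ≤ f x ∧ f x ≤ M) :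
    FTailOK (fun x => f x * s.toFun x) S u lo hi :=
  ftailOK_of_tailCheckI hc hf fun x hx => MI.mem_span (mem_ofRat S m) (mem_ofRat S M) (hb x hx).1 (hb x hx).2

end PolyMP

end Literature.Analysis.ValidatedNumerics
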